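import Summits.Ventures.PackingBounds.Energy.GramCongrCheck
import Summits.Ventures.PackingBounds.Energy.GramPSDMargin
import HarnessLib

/-!
# Faces of a congruence certificate: if `mᵀ X m = 0` then every face form `Σ_a B_{ai} z_a` vanishes

Framing: lottery ticket; floor = certified bounds/negative ranges. Venture `PackingBounds`, cell
`pub-packcert`, energy family E3PT (pub-packcert-energy gen 13; rigidity step of the `n = 4` kernel route).

Complement to `GramCongrCheck`: with the margin version of the integer PSD check (`GramData.checkDDm`,
`pd_of_checks_margin`: `m·Σ y_i² ≤ yᵀ Y y`, `m ≥ 1`) the transported identity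
`Σ_{a,b} X_{ab} z_a z_b = Σ_{i,j} Y_{ij} y_i y_j`, `y_i = Σ_a B_{ai} z_a` (`congr_quadForm`) shows: if the monomial-side
form vanishes, `listQuad z X 0 = 0`, then EVERY face form `y_i` vanishes (`faces_vanish_of_congr`). A single column
of `B` is read off the data by the Boolean `checkCol` (kernel evaluation) into the structurally unfolding linear form
`linForm` (`sum_ent_eq_linForm`), so a certificate file can name one face polynomial explicitly (e.g. a univariate
one, `(t - 1/6)(t + 2/3)` for the Petersen code) and conclude the value set of the inner products of a minimiser.
-/

namespace Summit.Ventures.PackingBounds.Energy.GramData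

open Finset

/-- `Σ_k (col[k] : ℝ) · z (a0 + k)`, structurally in the list `col`. -/
def linForm (z : ℕ → ℝ) : List ℤ → ℕ → ℝ
  | [], _ => 0
  | c :: cs, a => (c : ℝ) * z a + linForm z cs (a + 1)

/-- `linForm` as an indexed sum. -/
theorem linForm_eq (z : ℕ → ℝ) :
    ∀ (col : List ℤ) (a0 : ℕ), linForm z col a0 = ∑ k ∈ range col.length, (col.getD k 0 : ℝ) * z (a0 + k)
  | [], a0 => by simp [linForm]
  | c :: cs, a0 => by
    rw [linForm, List.length_cons, Finset.sum_range_succ', linForm_eq z cs (a0 + 1)]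
    simp only [List.getD_cons_zero, List.getD_cons_succ, Nat.add_zero]
    rw [add_comm]
    congr 1
    refine Finset.sum_congr rfl fun k _ => ?_
    rw [show a0 + 1 + k = a0 + (k + 1) by omega]

/-- Column `i` of `B` (rows `a < A`) equals the list `col`. -/
def checkCol (A : ℕ) (B : List (List ℤ)) (i : ℕ) (col : List ℤ) : Bool :=
  (List.range A).all fun a => ent B a i == col.getD a 0

/-- A checked column turns the face form `Σ_a B_{ai} z_a` into the structural `linForm z col 0`. -/
theorem sum_ent_eq_linForm {A : ℕ} {B : List (List ℤ)} {i : ℕ} {col : List ℤ}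
    (h : checkCol A B i col = true) (hlen : col.length = A) (z : ℕ → ℝ) :
    ∑ a : Fin A, (ent B a i : ℝ) * z a = linForm z col 0 := by
  rw [linForm_eq, hlen, Fin.sum_univ_eq_sum_range (fun a => (ent B a i : ℝ) * z a) A]
  refine Finset.sum_congr rfl fun a ha => ?_
  simp only [checkCol, List.all_eq_true, List.mem_range, beq_iff_eq] at h
  rw [h a (Finset.mem_range.1 ha), Nat.zero_add]

/-- **Vanishing of the faces.** Under the congruence facts (`of_checkCongr`), the integer PSD facts WITH MARGIN
`m ≥ 1` for `Y` (`of_checkRows`, `of_checkDDm`) and the shape facts, `listQuad z X 0 = 0` forces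
`Σ_a B_{ai} z_a = 0` for every `i < r`. -/
theorem faces_vanish_of_congr (A r s m : ℕ) (hm : 1 ≤ m) (B Y X L E : List (List ℤ))
    (hXlen : X.length = A) (hXrow : ∀ a, a < A → (X.getD a []).length = A)
    (hB : ∀ a, a < A → (B.getD a []).length = r)
    (hX : ∀ a b, a < A → b < A → ent X a b = cgOuter Y (B.getD b []) (B.getD a []) 0)
    (hrows : ∀ i j, i < r → j < r → ent Y i j = dotRows L i j s + ent E i j ∧ ent E i j = ent E j i)
    (hddm : ∀ i, i < r → absRow E i r + 2 * (m : ℤ) ≤ 2 * ent E i i) (z : ℕ → ℝ)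
    (h0 : listQuad z X 0 = 0) :
    ∀ i : Fin r, ∑ a : Fin A, (ent B a i : ℝ) * z a = 0 := by
  have hq := congr_quadForm A r B Y X hB hX z
  rw [← listQuad_eq_sum_ent z X A hXlen hXrow, h0] at hq
  have hmar := pd_of_checks_margin r s m Y L E hrows hddm (fun i : Fin r => ∑ a : Fin A, (ent B a i : ℝ) * z a)
  rw [← hq] at hmar
  have hm' : (0 : ℝ) < (m : ℝ) := by exact_mod_cast hm
  have hs : ∑ i : Fin r, (∑ a : Fin A, (ent B a i : ℝ) * z a) ^ 2 ≤ 0 := by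
    by_contra hc
    have hc' : 0 < ∑ i : Fin r, (∑ a : Fin A, (ent B a i : ℝ) * z a) ^ 2 := lt_of_not_ge hc
    have := mul_pos hm' hc'
    linarith
  have hs0 : ∑ i : Fin r, (∑ a : Fin A, (ent B a i : ℝ) * z a) ^ 2 = 0 :=
    le_antisymm hs (Finset.sum_nonneg fun i _ => sq_nonneg _)
  intro i
  have hi := (Finset.sum_eq_zero_iff_of_nonneg (fun i _ => sq_nonneg _)).1 hs0 i (Finset.mem_univ i)
  exact pow_eq_zero_iff two_ne_zero |>.1 hi

end Summit.Ventures.PackingBounds.Energy.GramData
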